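import Mathlib
import Summits.NavierStokesRegularity.NavierStokesRegularity.Theorems.FilamentSkeletonRssStadiumRealJunction
import Summits.NavierStokesRegularity.NavierStokesRegularity.Theorems.FilamentSkeletonRssStadiumOwnReal

/-!
# Route `FilamentSkeletonRss` · cruxes `SkeletonJ1L` (stmt-NavierStokesRegularity-23296, registered stub `stub_tangentSkeletonL` ≡
# `TangentSkeletonNearStraightL`, stmt-23320) · line `child_tangent_analytic_strip_L` (b0b56c52900dd90a), stub `stub_stripPropagation` —
# brick for `rcore`: AT A REAL TARGET THE TENT LIES ON THE REAL AXIS AND THE TENT FIELD IS THE REAL BIOT–SAVART TRACE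

Second clause of the quarter core (real agreement `U t = u X (X j t)` coordinatewise complexified).  At a real target `t` the tent of `t` has all
its vertices on the real axis (plateau at height `0`, degenerate descent): `P k = p k ∈ ℝ`, `p 0 = ℓ`, `p n = r`, every segment inside the real
trace.  Then every polygon segment is an interval integral of the real-source kernel `g_t` (`Theorems.StadiumRealJunction.real_junction_eq`), the
segments are adjacent (`intervalIntegral.sum_integral_adjacent_intervals`), and with the two feet the tent integral is the integral of `g_t` over
the whole line (`tent_real_eq_integral`); by `Theorems.StadiumOwnReal.own_real_setIntegral_eq` (on `univ`) that is the coordinatewise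
complexification of the stub's own real Biot–Savart integral (`tent_real_trace`).  Kernels by defining equations as in
`Theorems.StadiumTentFreezeNhds`.
HONEST FRAMING: bookkeeping for a HYPOTHETICAL filament skeleton on the NEGATIVE side of a MODEL route; the stub `stub_stripPropagation` is NOT closed by
this file, `TangentSkeletonNearStraightL` / `SkeletonJ1L` stay OPEN; nothing here bears on Navier–Stokes regularity or blow-up.
`--supports stmt-NavierStokesRegularity-23320` (≡ stub `stub_tangentSkeletonL` of 23296).
-/

set_option linter.dupNamespace false

noncomputable section

namespace Summit.NavierStokesRegularity.NavierStokesRegularity.Theorems.StadiumTentRealTrace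

open Set MeasureTheory Complex Finset
open scoped InnerProductSpace Matrix
open Literature.Analysis.FluidPDE
open Summit.NavierStokesRegularity.NavierStokesRegularity.Theorems.StadiumRealJunction
open Summit.NavierStokesRegularity.NavierStokesRegularity.Theorems.StadiumOwnReal

/-- **At a real target the tent integral is the whole-line integral of the real-source kernel.**  Stadium data with real traces (`hFX`, `hGX`);
kernels `f` (complex sources) and `g` (real sources) by their defining equations; a polygon with REAL vertices `p 0 = ℓ, …, p n = r` whose
segments lie in the real trace; `g_z` integrable on `ℝ` for the target `z`.  Then
`∫_{Iic ℓ} g_z + Σ_{k<n} [p k, p (k+1)]_{f_z} + ∫_{Ioi r} g_z = ∫_ℝ g_z`. [folklore] -/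
theorem tent_real_eq_integral {hs L cc : ℝ} {F : ℂ → (Fin 3 → ℂ)}
    (hF : DifferentiableOn ℂ F {z : ℂ | |z.im| < hs ∧ |z.re - cc| < L + hs})
    {X : ℝ → EuclideanSpace ℝ (Fin 3)} (hX : Differentiable ℝ X)
    (hFX : ∀ r : ℝ, (r : ℂ) ∈ {z : ℂ | |z.im| < hs ∧ |z.re - cc| < L + hs} →
      F r = fun i => ((⟪X r, EuclideanSpace.single i (1:ℝ)⟫_ℝ : ℝ) : ℂ))
    {G : ℂ → ℂ} {A : ℝ → ℝ}
    (hGX : ∀ r : ℝ, (r : ℂ) ∈ {z : ℂ | |z.im| < hs ∧ |z.re - cc| < L + hs} → G r = ((A r : ℝ) : ℂ))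
    (hhs : 0 < hs) {κ : ℝ}
    {f : ℂ → ℂ → (Fin 3 → ℂ)}
    (hf : ∀ z ζ, f z ζ = (((∑ i, (F z i - F ζ i) ^ 2) + (κ : ℂ) * G ζ) ^ ((3:ℂ) / 2))⁻¹ •
      (deriv F ζ ⨯₃ (fun i => F z i - F ζ i)))
    {g : ℂ → ℝ → (Fin 3 → ℂ)}
    (hg : ∀ z σ, g z σ = (((∑ i, (F z i - ((X σ i : ℝ) : ℂ)) ^ 2) + ((κ * A σ : ℝ) : ℂ)) ^ ((3:ℂ) / 2))⁻¹ •
      ((fun i => ((deriv X σ i : ℝ) : ℂ)) ⨯₃ (fun i => F z i - ((X σ i : ℝ) : ℂ))))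
    {p : ℕ → ℝ} {n : ℕ} (htrace : ∀ k < n, ∀ σ ∈ uIcc (p k) (p (k+1)), |σ - cc| < L + hs)
    {z : ℂ} (hgi : Integrable (g z)) :
    (∫ σ in Iic (p 0), g z σ) +
        (∑ k ∈ range n, ∫ t in (0:ℝ)..1, ((p (k+1) : ℂ) - (p k : ℂ)) •
          f z ((p k : ℂ) + (t : ℂ) * ((p (k+1) : ℂ) - (p k : ℂ)))) +
        (∫ σ in Ioi (p n), g z σ) = ∫ σ, g z σ := by
  have hfz : f z = fun ζ => (((∑ i, (F z i - F ζ i) ^ 2) + (κ : ℂ) * G ζ) ^ ((3:ℂ) / 2))⁻¹ •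
      (deriv F ζ ⨯₃ (fun i => F z i - F ζ i)) := funext (hf z)
  have hgz : g z = fun σ => (((∑ i, (F z i - ((X σ i : ℝ) : ℂ)) ^ 2) + ((κ * A σ : ℝ) : ℂ)) ^ ((3:ℂ) / 2))⁻¹ •
      ((fun i => ((deriv X σ i : ℝ) : ℂ)) ⨯₃ (fun i => F z i - ((X σ i : ℝ) : ℂ))) := funext (hg z)
  -- each polygon segment is an interval integral of `g z`
  have hseg : ∀ k < n, (∫ t in (0:ℝ)..1, ((p (k+1) : ℂ) - (p k : ℂ)) •
      f z ((p k : ℂ) + (t : ℂ) * ((p (k+1) : ℂ) - (p k : ℂ)))) = ∫ σ in (p k)..(p (k+1)), g z σ := by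
    intro k hk
    have h := real_junction_eq hF hX hFX hGX hhs κ z (htrace k hk)
    rw [hgz]
    simpa [hfz] using h
  rw [Finset.sum_congr rfl fun k hk => hseg k (Finset.mem_range.mp hk)]
  rw [intervalIntegral.sum_integral_adjacent_intervals fun k _ => hgi.intervalIntegrable]
  -- feet + middle = whole line
  have h1 := intervalIntegral.integral_interval_add_Ioi (hgi.integrableOn (s := Ioi (p 0))) (hgi.integrableOn (s := Ioi (p n)))
  have h2 := intervalIntegral.integral_Iic_add_Ioi (hgi.integrableOn (s := Iic (p 0))) (hgi.integrableOn (s := Ioi (p 0)))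
  rw [add_assoc, h1, h2]

/-- **At a real target the tent field is the real Biot–Savart trace.**  As above, for a REAL target `t` in the real trace, with the stub's own-filament
data (`X ∈ C¹` unit speed, tangent oscillation `≤ 1/2`, continuous core `A ≥ Λ⁻¹`, `κ > 0`): the tent integral at `t` equals the coordinatewise
complexification of `∫_ℝ ((‖X t − X σ‖² + κ A σ)^{3/2})⁻¹ • (X′ σ × (X t − X σ)) dσ` (`Theorems.StadiumOwnReal.own_real_setIntegral_eq`). [folklore] -/
theorem tent_real_trace {hs L cc Λ : ℝ} {F : ℂ → (Fin 3 → ℂ)}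
    (hF : DifferentiableOn ℂ F {z : ℂ | |z.im| < hs ∧ |z.re - cc| < L + hs})
    {X : ℝ → EuclideanSpace ℝ (Fin 3)} (hX : ContDiff ℝ 1 X) (hXu : ∀ σ, ‖deriv X σ‖ = 1)
    (hosc : ∀ τ σ, ‖deriv X τ - deriv X σ‖ ≤ 1 / 2)
    (hFX : ∀ r : ℝ, (r : ℂ) ∈ {z : ℂ | |z.im| < hs ∧ |z.re - cc| < L + hs} →
      F r = fun i => ((⟪X r, EuclideanSpace.single i (1:ℝ)⟫_ℝ : ℝ) : ℂ))
    {G : ℂ → ℂ} {A : ℝ → ℝ} (hAc : Continuous A) (hΛ : 0 < Λ) (hA : ∀ σ, Λ⁻¹ ≤ A σ)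
    (hGX : ∀ r : ℝ, (r : ℂ) ∈ {z : ℂ | |z.im| < hs ∧ |z.re - cc| < L + hs} → G r = ((A r : ℝ) : ℂ))
    (hhs : 0 < hs) {κ : ℝ} (hκ : 0 < κ)
    {f : ℂ → ℂ → (Fin 3 → ℂ)}
    (hf : ∀ z ζ, f z ζ = (((∑ i, (F z i - F ζ i) ^ 2) + (κ : ℂ) * G ζ) ^ ((3:ℂ) / 2))⁻¹ •
      (deriv F ζ ⨯₃ (fun i => F z i - F ζ i)))
    {g : ℂ → ℝ → (Fin 3 → ℂ)}
    (hg : ∀ z σ, g z σ = (((∑ i, (F z i - ((X σ i : ℝ) : ℂ)) ^ 2) + ((κ * A σ : ℝ) : ℂ)) ^ ((3:ℂ) / 2))⁻¹ •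
      ((fun i => ((deriv X σ i : ℝ) : ℂ)) ⨯₃ (fun i => F z i - ((X σ i : ℝ) : ℂ))))
    {p : ℕ → ℝ} {n : ℕ} (htrace : ∀ k < n, ∀ σ ∈ uIcc (p k) (p (k+1)), |σ - cc| < L + hs)
    {t : ℝ} (ht : |t - cc| < L + hs) (hgi : Integrable (g (t : ℂ))) :
    (∫ σ in Iic (p 0), g (t : ℂ) σ) +
        (∑ k ∈ range n, ∫ s in (0:ℝ)..1, ((p (k+1) : ℂ) - (p k : ℂ)) •
          f (t : ℂ) ((p k : ℂ) + (s : ℂ) * ((p (k+1) : ℂ) - (p k : ℂ)))) +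
        (∫ σ in Ioi (p n), g (t : ℂ) σ) =
      fun i => (((∫ σ : ℝ, ((‖X t - X σ‖ ^ 2 + κ * A σ) ^ (3/2 : ℝ))⁻¹ • cross (deriv X σ) (X t - X σ)) i : ℝ) : ℂ) := by
  rw [tent_real_eq_integral hF hX.differentiable_one hFX hGX hhs hf hg htrace hgi]
  have h := own_real_setIntegral_eq hFX hX hXu hosc hAc hΛ hA hκ hhs ht (κ := κ) Set.univ
  simp only [Measure.restrict_univ] at h
  rw [funext (hg (t : ℂ))]
  exact h

end Summit.NavierStokesRegularity.NavierStokesRegularity.Theorems.StadiumTentRealTrace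

end
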